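import Literature.NumberTheory.EllipticCurves.RingClassFieldDecompositionGroupGenerator
import Literature.NumberTheory.EllipticCurves.RingClassFieldInertiaGenerator
import Literature.NumberTheory.EllipticCurves.HuShuYin2019.SylvesterPairAdditivePlaces
import Mathlib.NumberTheory.NumberField.Cyclotomic.Three
import HarnessLib

/-!
# The prime `w = (1 − ω)` of `K = ℚ(ω)` in the ring class field `K[m] ⊂ ℂ` for `3 ∤ m`, `p ∣ m`, `p ≡ 1 (3)`:
# its class `[w]_m ∈ I_K(m)/P_{K,ℤ}(m)` has order EXACTLY `2`; hence `w` is unramified in `K[m]` with residue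
# degree `f_w(K[m]/K) = 2`, and every Frobenius above `w` acts on `K[m]` as an INVOLUTION `σ ≠ 1` of `Gal(K[m]/K)`

Topic `NumberTheory/EllipticCurves/HuShuYin2019` (vocabulary of `HeegnerPointsOfConductor.lean`: the concrete ring
class field `K[m] = ringClassField K ι m ⊂ ℂ`, `ringClassGal ι m = Gal(K[m]/K) ≤ Aut_ℚ K[m]`; of
`QuadraticFields/RingClass*.lean`: `RingClassGroup K m = I_K(m)/P_{K,ℤ}(m)`, `primeClass m v = [v]_m`, Cox's `θ_m`;
of `NumberFields/RingClassFieldDecompositionLaw.lean`: `e`, `f` of a prime `v ∤ m` in `K[m]`; of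
`RingClassFieldInertiaGenerator.lean` §1: `emb(K[m]) = R_m` for ANY `K`-embedding `emb : K[m] → K̄`; of
`IntegralGaloisAction.lean`: `𝔚 ∈ w.primesAbove`, `IsArithFrobAt`).  Sequel of `SylvesterPairAdditivePlaces.lean`
(`(3) = w²`) and of `NumberFields/RingClassFieldRamifiedLayer.lean` §5 / `RingClassFieldInertiaGenerator.lean` §5
(the inertia group at `w` of `Gal(K[9m]/K)` is `Gal(K[9m]/K[m])`), which say «NOT HERE: the Frobenius part of `D_w`».
THEOREMS ONLY (no definition, no named fact, no instance, no `sorry`; D-0026, net debt 0).  Seat `bsd-cm-k-ty1`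
(cell bsd-cm, crux `UpperOffV0HSYPlus`), planner WANT (W2-d)-(β): this file serves the DISCHARGE of the local
conjunct at `w ∣ 3` of leaf (L1) at `p ≡ 7 (9)` (the decomposition group `D_w ≤ Gal(K[9m]/K)` behind the open
subgroup `Φ ≤ Γ_{K_w}` of `KolyvaginClassLocalConditionCoprimeIndex` §5); it is NOT consumed by the rows' chain at
the level, which DISPLAYS that conjunct as a binder.  No summit statement is proved or advanced by this file alone.

## THE PRINT

Cox [Cox2013], Cor. 5.21 (ii) (PDF p. 122): «The order of `((L/K)/𝔓)` is the inertial degree `f = f_{𝔓|𝔭}`»;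
§9.A (9.1) (PDF pp. 192–193): «`C(𝒪) ≃ I_K(f)/P_{K,ℤ}(f) ≃ Gal(L/K)` … all primes of `K` ramified in `L` must
divide `f𝒪_K`»; §7.D (7.27) (PDF p. 161) with Exercise 7.30 (a) (PDF p. 171) for `𝒪_K^* ≠ {±1}`: the exact sequence
`1 → {±1} → (ℤ/fℤ)^* × 𝒪_K^* → (𝒪_K/f𝒪_K)^* → I_K(f) ∩ P_K/P_{K,ℤ}(f) → 1`, i.e. a principal `α𝒪_K` prime to
`f` lies in `P_{K,ℤ}(f)` iff `εα ≡ a (mod f𝒪_K)` for a unit `ε` and an integer `a` prime to `f` (tree: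
`RingClass.theta_eq_one_iff`).  Neukirch [NeukirchANT1999] VI (7.3) (decomposition law in class fields).
Hu–Shu–Yin [HuShuYin2019] §2.2 (PDF pp. 6–8): the tower `H_{9p} ⊇ H_{3p} ⊇ H_p ⊇ K = ℚ(√−3)`, `p ≡ 1 (mod 3)`,
Prop. 2.4.  The computation itself is routine and is not printed in these sources: `(1 − ω)² = −3ω`, so
`[w]_m² = [(3)] = 1` (`gcd(3, m) = 1`); and `[w]_m = 1` would give `ω − 1 ≡ εa (mod p𝒪_K)` for one of the SIX units
`ε = ±ω^k`; applying the non-trivial automorphism of `K` and eliminating `a` gives `p ∣ 2(2ω + 1)` in `𝒪_K` in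
each of the six cases, so `p² ∣ N(2(2ω + 1)) = 12` — impossible since `p ≡ 1 (3)` forces `p ≥ 7`.

## WHAT IS FORMALISED (`K : Type` with `ω² + ω + 1 = 0`, `[K:ℚ] = 2`; `w ∋ 3` a prime of `𝓞 K`; `ι : K → ℂ`;
## `3 ∤ m`; `p` prime, `p % 3 = 1`, `p ∣ m`)

* §1 `JZero.asIdeal_eq_span_toInteger_sub_one` — `w = (ζ − 1)`; `JZero.not_span_natCast_le_of_not_three_dvd` —
  `m𝓞_K ⊄ w`; `JZero.primeClass_three_sq` — **`[w]_m² = 1`** (`m ≠ 1`, `3 ∤ m`); `JZero.primeClass_three_ne_one` —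
  **`[w]_m ≠ 1`**; `JZero.orderOf_primeClass_three` — **`orderOf [w]_m = 2`**.
* §2 `JZero.inertiaDegIn_ringClassField_three` — **`f_w(K[m]/K) = 2`**; `JZero.ramificationIdxIn_ringClassField_three`
  — `e_w(K[m]/K) = 1`; `JZero.exists_involution_apply_emb_eq_of_isArithFrobAt_three` — **for any `K`-embedding
  `emb : K[m] → K̄`, any `𝔚 ∈ w.primesAbove` and any arithmetic Frobenius `F ∈ Γ_K` at `𝔚` there is
  `σ ∈ ringClassGal ι m`, `σ ≠ 1`, `σ * σ = 1`, with `F ∘ emb = emb ∘ σ`** (the Frobenius involution of `D_w`).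

NOT HERE: `#Gal(K[9m]/K[m]) = 9` (sibling `SylvesterTowerRamifiedLayerDegree.lean`), hence `#D_𝔚(K[9m]/K) = 18`
with `RingClassFieldInertiaGenerator` §5; anything about elliptic curves or Heegner points.

Proof: §1 by Cox's `θ_m` (`RingClass.primeClass_pow_eq_theta`, `theta_eq_one_iff`), Mathlib's
`IsCyclotomicExtension.Rat.Three.Units.mem` (the six units of `ℚ(ζ₃)`), `IsPrimitiveRoot.zeta_sub_one_prime'`, and
norms `Algebra.norm ℤ` on `𝓞 K` (`Algebra.norm_algebraMap`, `RingOfIntegers.rank`); §2 by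
`inertiaDegIn_ringClassField_eq_orderOf_primeClass` / `ramificationIdxIn_ringClassField_eq_one` and the `K̄`-side
Artin isomorphism `RingClassField.exists_artinEquiv_abs` on `emb(K[m]) = R_m` (`fieldRange_emb_ringClassField_eq`),
transported along `K[m] ≃ₐ[K] emb(K[m])` (`AlgEquiv.ofInjectiveField`, `AlgEquiv.autCongr`) as in
`RingClassFieldInertiaGenerator` §2.

## References

* D. A. Cox, *Primes of the form x² + ny²*, 2nd ed., Wiley 2013: Cor. 5.21 (ii); §7.D (7.27), Thm. 7.24,
  Exercise 7.30; §9.A (9.1). [Cox2013]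
* J. Neukirch, *Algebraic Number Theory*, Springer 1999, Ch. VI §7 (7.3). [NeukirchANT1999]
* Y. Hu, J. Shu, H. Yin, *An explicit Gross–Zagier formula related to the Sylvester conjecture*, Trans. AMS 372
  (2019), arXiv:1708.05266, §2.2, Prop. 2.4. [HuShuYin2019]
* B. H. Gross, *Kolyvagin's work on modular elliptic curves*, LMS LNS 153 (1991), §3. [GrossLMS1991]

## Mathlib / tree search

Tree: `JZero.span_three_eq_asIdeal_sq`, `JZero.exists_aut_apply_eq_sq`, `primeClass_pow_eq_theta`, `theta_eq_one_iff`,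
`inertiaDegIn_ringClassField_eq_orderOf_primeClass`, `exists_artinEquiv_abs`, `fieldRange_emb_ringClassField_eq`.
Mathlib: `IsCyclotomicExtension.Rat.Three.Units.mem`, `IsPrimitiveRoot.zeta_sub_one_prime'`, `orderOf_eq_prime`,
`MulEquiv.orderOf_eq`, `AlgEquiv.autCongr`, `AlgEquiv.ofInjectiveField`.
-/

noncomputable section

open scoped Classical NumberField
open NumberField IsDedekindDomain IsDedekindDomain.HeightOneSpectrum Module Field

namespace Literature.NumberTheory.EllipticCurves.HuShuYin2019

open Literature.NumberTheory.EllipticCurves Literature.NumberTheory.GaloisRepresentations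
open Literature.NumberTheory.NumberFields Literature.NumberTheory.NumberFields.RingClassField
open Literature.NumberTheory.QuadraticFields Literature.NumberTheory.QuadraticFields.RingClass
open Literature.NumberTheory.QuadraticFields.Quadratic

variable {K : Type} [Field K] [NumberField K] {ω : K}

/-! ## §1 The prime `w = (1 − ω)` of `K = ℚ(ω)` and its class in `I_K(m)/P_{K,ℤ}(m)` -/

/-- `w = (ζ − 1)`: the prime of `K = ℚ(ω)` above `3` is generated by `ζ − 1` (`ζ = ω` as an algebraic integer).
[cite: Cox2013, §4.A Prop. 4.7 (i) (PDF p. 95: `1 − ω` is prime in `ℤ[ω]` and `3 = −ω²(1 − ω)²`)] -/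
theorem JZero.asIdeal_eq_span_toInteger_sub_one (hω : ω ^ 2 + ω + 1 = 0) (h2 : finrank ℚ K = 2)
    (hζ : IsPrimitiveRoot ω 3) (w : HeightOneSpectrum (𝓞 K)) (h3w : ((3 : ℕ) : 𝓞 K) ∈ w.asIdeal) :
    w.asIdeal = Ideal.span {hζ.toInteger - 1} := by
  haveI := JZero.isCyclotomicExtension_three_of_sq_add_self_add_one hω h2
  have hprime : Prime (hζ.toInteger - 1) := hζ.zeta_sub_one_prime'
  have hne : (Ideal.span {hζ.toInteger - 1} : Ideal (𝓞 K)) ≠ ⊥ := by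
    rw [Ne, Ideal.span_singleton_eq_bot]
    exact hprime.ne_zero
  have hP : (Ideal.span {hζ.toInteger - 1} : Ideal (𝓞 K)).IsPrime :=
    (Ideal.span_singleton_prime hprime.ne_zero).mpr hprime
  -- `3 ∈ (ζ − 1)`
  have h3 : ((3 : ℕ) : 𝓞 K) ∈ Ideal.span {hζ.toInteger - 1} := by
    rw [Ideal.mem_span_singleton]
    have := hζ.toInteger_sub_one_dvd_prime'
    exact_mod_cast this
  -- both primes square to `(3)`
  set v : HeightOneSpectrum (𝓞 K) := ⟨Ideal.span {hζ.toInteger - 1}, hP, hne⟩ with hv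
  have hsqv := JZero.span_three_eq_asIdeal_sq hω h2 v h3
  have hsqw := JZero.span_three_eq_asIdeal_sq hω h2 w h3w
  have hsq : w.asIdeal ^ 2 = v.asIdeal ^ 2 := hsqw.symm.trans hsqv
  -- `w ∣ v²` so `w ∣ v`, and both are maximal
  have hdvd : w.asIdeal ∣ v.asIdeal := by
    have h1 : w.asIdeal ∣ v.asIdeal ^ 2 := by rw [← hsq]; exact dvd_pow_self _ two_ne_zero
    exact (Ideal.prime_of_isPrime w.ne_bot w.isPrime).dvd_of_dvd_pow h1
  have hle : v.asIdeal ≤ w.asIdeal := Ideal.le_of_dvd hdvd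
  exact ((Ideal.IsPrime.isMaximal hP hne).eq_of_le w.isPrime.ne_top hle).symm

omit [NumberField K] in
/-- `m𝓞_K ⊄ w` for `3 ∤ m` (`w ∋ 3`): `gcd(3, m) = 1`, so `w` is prime to the conductor `m`.
[cite: Cox2013, §4.A Prop. 4.7 (i) and §9.A (PDF pp. 95, 192: ideals prime to `f𝒪_K`)] -/
theorem JZero.not_span_natCast_le_of_not_three_dvd (w : HeightOneSpectrum (𝓞 K))
    (h3w : ((3 : ℕ) : 𝓞 K) ∈ w.asIdeal) {m : ℕ} (hm3 : ¬ 3 ∣ m) :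
    ¬ Ideal.span {(m : 𝓞 K)} ≤ w.asIdeal := by
  intro hle
  have hmw : (m : 𝓞 K) ∈ w.asIdeal := hle (Ideal.mem_span_singleton_self _)
  have hcop : IsCoprime ((3 : ℕ) : ℤ) (m : ℤ) :=
    Nat.isCoprime_iff_coprime.mpr ((Nat.Prime.coprime_iff_not_dvd Nat.prime_three).mpr hm3)
  obtain ⟨u, v, huv⟩ := hcop
  apply w.isPrime.ne_top
  rw [Ideal.eq_top_iff_one]
  have h1 : (1 : 𝓞 K) = (u : 𝓞 K) * ((3 : ℕ) : 𝓞 K) + (v : 𝓞 K) * (m : 𝓞 K) := by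
    have := congrArg (Int.cast : ℤ → 𝓞 K) huv
    push_cast at this ⊢
    exact this.symm
  rw [h1]
  exact Submodule.add_mem _ (Ideal.mul_mem_left _ _ h3w) (Ideal.mul_mem_left _ _ hmw)

/-- **`[w]_m² = 1`** in `I_K(m)/P_{K,ℤ}(m)` (`3 ∤ m`, `m ≠ 1`): `w² = (3) ∈ P_{K,ℤ}(m)`.
[cite: Cox2013, §7.D (7.27) and §9.A (9.1) (PDF pp. 161, 192; with Prop. 4.7 (i): `3 = −ω²(1 − ω)²`)] -/
theorem JZero.primeClass_three_sq (hω : ω ^ 2 + ω + 1 = 0) (h2 : finrank ℚ K = 2)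
    (w : HeightOneSpectrum (𝓞 K)) (h3w : ((3 : ℕ) : 𝓞 K) ∈ w.asIdeal) {m : ℕ} (hm1 : m ≠ 1)
    (hm3 : ¬ 3 ∣ m) : primeClass m w ^ 2 = 1 := by
  obtain ⟨b, hb⟩ := exists_basis_zero_eq_one h2
  have hωb := basis_one_mul_self_eq b hb
  have hfn : Ideal.span {(m : 𝓞 K)} ≠ ⊤ := span_natCast_ne_top_of_ne_one b hb hm1
  have hv := JZero.not_span_natCast_le_of_not_three_dvd w h3w hm3
  have hβ : w.asIdeal ^ 2 = Ideal.span {((3 : ℕ) : 𝓞 K)} :=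
    (JZero.span_three_eq_asIdeal_sq hω h2 w h3w).symm
  rw [primeClass_pow_eq_theta b hb hωb hfn hv hβ, theta_eq_one_iff]
  refine ⟨1, 3, Nat.isCoprime_iff_coprime.mpr ((Nat.Prime.coprime_iff_not_dvd Nat.prime_three).mpr hm3), ?_⟩
  rw [IsUnit.unit_spec]
  push_cast
  ring_nf

/-- **`[w]_m ≠ 1`** in `I_K(m)/P_{K,ℤ}(m)` once a prime `p ≡ 1 (3)` divides `m` (`3 ∤ m`): no unit multiple of
`ω − 1` is congruent to a rational integer modulo `p𝓞_K`.
[cite: Cox2013, §7.D (7.27) with Exercise 7.30 (a) (PDF pp. 161, 171: `α𝒪_K ∈ P_{K,ℤ}(f)` iff `εα ≡ a (mod f𝒪_K)`, `ε ∈ 𝒪_K^*`)] -/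
theorem JZero.primeClass_three_ne_one (hω : ω ^ 2 + ω + 1 = 0) (h2 : finrank ℚ K = 2)
    (w : HeightOneSpectrum (𝓞 K)) (h3w : ((3 : ℕ) : 𝓞 K) ∈ w.asIdeal) {m p : ℕ} (hm3 : ¬ 3 ∣ m)
    (hp : p.Prime) (hp3 : p % 3 = 1) (hpm : p ∣ m) : primeClass m w ≠ 1 := by
  -- standing facts on `K = ℚ(ω)`
  obtain ⟨hζ, -, σ, hσω, -⟩ := JZero.exists_aut_apply_eq_sq K hω h2
  haveI := JZero.isCyclotomicExtension_three_of_sq_add_self_add_one hω h2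
  set t : 𝓞 K := hζ.toInteger with ht_def
  have htK : (t : K) = ω := rfl
  have ht : t ^ 2 + t + 1 = 0 := by
    apply RingOfIntegers.ext
    simp only [map_add, map_pow, map_one, map_zero]
    exact hω
  have ht3 : t ^ 3 = 1 := by linear_combination (t - 1) * ht
  -- `p ≥ 7`
  have hp7 : 7 ≤ p := by
    by_contra h
    have h2p := hp.two_le
    interval_cases p <;> simp_all (config := { decide := true })
  have hm1 : m ≠ 1 := by
    rintro rfl
    exact absurd (Nat.le_of_dvd one_pos hpm) (by omega)
  -- the class of `w = (t − 1)` is `θ_m(t − 1)`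
  obtain ⟨b, hb⟩ := exists_basis_zero_eq_one h2
  have hωb := basis_one_mul_self_eq b hb
  have hfn : Ideal.span {(m : 𝓞 K)} ≠ ⊤ := span_natCast_ne_top_of_ne_one b hb hm1
  have hv := JZero.not_span_natCast_le_of_not_three_dvd w h3w hm3
  have hβ : w.asIdeal ^ 1 = Ideal.span {t - 1} := by
    rw [pow_one]; exact JZero.asIdeal_eq_span_toInteger_sub_one hω h2 hζ w h3w
  intro h1
  have hθ := primeClass_pow_eq_theta b hb hωb hfn hv hβ
  rw [pow_one, h1] at hθ
  obtain ⟨ε, a, -, hεa⟩ := (theta_eq_one_iff b hb hωb hfn _).mp hθ.symm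
  rw [IsUnit.unit_spec] at hεa
  -- `t − 1 ≡ ε a (mod m)`, hence `(mod p)`
  have hcong : (p : 𝓞 K) ∣ (t - 1) - (ε : 𝓞 K) * (a : 𝓞 K) := by
    have hm : (m : 𝓞 K) ∣ (t - 1) - (ε : 𝓞 K) * (a : 𝓞 K) :=
      Ideal.mem_span_singleton.mp (Ideal.Quotient.eq.mp hεa)
    exact (Nat.cast_dvd_cast hpm).trans hm
  -- the conjugation `τ = σ|𝓞 K`: `τ t = t²`, `τ` fixes `ℤ`
  set τ : 𝓞 K →+* 𝓞 K := RingOfIntegers.mapRingHom (σ : K →+* K) with hτ_def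
  have hτt : τ t = t ^ 2 := by
    apply RingOfIntegers.ext
    change σ (t : K) = ((t ^ 2 : 𝓞 K) : K)
    rw [RingOfIntegers.coe_eq_algebraMap, RingOfIntegers.coe_eq_algebraMap, map_pow]
    exact hσω
  have hcong' : (p : 𝓞 K) ∣ τ (t - 1) - τ (ε : 𝓞 K) * (a : 𝓞 K) := by
    obtain ⟨c, hc⟩ := hcong
    refine ⟨τ c, ?_⟩
    have := congrArg τ hc
    rw [map_sub, map_mul, map_mul, map_intCast, map_natCast] at this
    exact this
  -- eliminate `a`: `p ∣ (t − 1)·τε − τ(t − 1)·ε`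
  have hx : (p : 𝓞 K) ∣ (t - 1) * τ (ε : 𝓞 K) - τ (t - 1) * (ε : 𝓞 K) := by
    have := (hcong.mul_right (τ (ε : 𝓞 K))).sub (hcong'.mul_right (ε : 𝓞 K))
    have e : ((t - 1) - (ε : 𝓞 K) * (a : 𝓞 K)) * τ (ε : 𝓞 K) -
        (τ (t - 1) - τ (ε : 𝓞 K) * (a : 𝓞 K)) * (ε : 𝓞 K) =
        (t - 1) * τ (ε : 𝓞 K) - τ (t - 1) * (ε : 𝓞 K) := by ring
    rwa [e] at this
  rw [map_sub, map_one, hτt] at hx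
  -- the six units: in every case `p ∣ 2(2t + 1)`
  have key : (p : 𝓞 K) ∣ 2 * (2 * t + 1) := by
    have hmem := IsCyclotomicExtension.Rat.Three.Units.mem hζ ε
    simp only [List.mem_cons, List.not_mem_nil, or_false] at hmem
    have hη : ((IsPrimitiveRoot.isUnit (hζ.toInteger_isPrimitiveRoot) (by decide)).unit : 𝓞 K) = t :=
      IsUnit.unit_spec _
    rcases hmem with rfl | rfl | rfl | rfl | rfl | rfl
    · rw [Units.val_one, map_one] at hx
      have e : (t - 1) * 1 - (t ^ 2 - 1) * 1 = 2 * t + 1 := by linear_combination (-1 : 𝓞 K) * ht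
      rw [e] at hx
      exact hx.mul_left 2
    · rw [Units.val_neg, Units.val_one, map_neg, map_one] at hx
      have e : (t - 1) * -1 - (t ^ 2 - 1) * -1 = -(2 * t + 1) := by linear_combination ht
      rw [e, dvd_neg] at hx
      exact hx.mul_left 2
    · rw [hη, hτt] at hx
      have e : (t - 1) * t ^ 2 - (t ^ 2 - 1) * t = 2 * t + 1 := by linear_combination (-1 : 𝓞 K) * ht
      rw [e] at hx
      exact hx.mul_left 2
    · rw [Units.val_neg, map_neg, hη, hτt] at hx
      have e : (t - 1) * -t ^ 2 - (t ^ 2 - 1) * -t = -(2 * t + 1) := by linear_combination ht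
      rw [e, dvd_neg] at hx
      exact hx.mul_left 2
    · rw [Units.val_pow_eq_pow_val, map_pow, hη, hτt] at hx
      have e : (t - 1) * (t ^ 2) ^ 2 - (t ^ 2 - 1) * t ^ 2 = -(2 * (2 * t + 1)) := by
        linear_combination (t ^ 2 - 2 * t) * ht3 + (2 : 𝓞 K) * ht
      rw [e, dvd_neg] at hx
      exact hx
    · rw [Units.val_neg, Units.val_pow_eq_pow_val, map_neg, map_pow, hη, hτt] at hx
      have e : (t - 1) * -(t ^ 2) ^ 2 - (t ^ 2 - 1) * -t ^ 2 = 2 * (2 * t + 1) := by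
        linear_combination (-(t ^ 2 - 2 * t)) * ht3 + (-2 : 𝓞 K) * ht
      rwa [e] at hx
  -- norms: `N(p) = p²`, `N(2) = 4`, `N(2t+1)² = N(−3) = 9`
  have hrank : finrank ℤ (𝓞 K) = 2 := by rw [RingOfIntegers.rank, h2]
  have hNp : Algebra.norm ℤ (p : 𝓞 K) = (p : ℤ) ^ 2 := by
    rw [show (p : 𝓞 K) = algebraMap ℤ (𝓞 K) (p : ℤ) by simp, Algebra.norm_algebraMap, hrank]
  have hN2 : Algebra.norm ℤ (2 : 𝓞 K) = 4 := by
    rw [show (2 : 𝓞 K) = algebraMap ℤ (𝓞 K) 2 by simp, Algebra.norm_algebraMap, hrank]; norm_num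
  have hsq : (2 * t + 1) ^ 2 = algebraMap ℤ (𝓞 K) (-3) := by
    rw [map_neg, map_ofNat]; linear_combination (4 : 𝓞 K) * ht
  have hN3 : (Algebra.norm ℤ (2 * t + 1)) ^ 2 = 9 := by
    rw [← map_pow, hsq, Algebra.norm_algebraMap, hrank]; norm_num
  have hN3' : (Algebra.norm ℤ (2 * t + 1)).natAbs = 3 := by
    have h9 : (Algebra.norm ℤ (2 * t + 1)).natAbs ^ 2 = 3 ^ 2 := by
      zify; rw [sq_abs]; exact_mod_cast hN3
    exact Nat.pow_left_injective two_ne_zero h9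
  obtain ⟨y, hy⟩ := key
  have hN := congrArg (fun z => (Algebra.norm ℤ z).natAbs) hy
  simp only [map_mul, Int.natAbs_mul, hNp, hN2, hN3', Int.natAbs_pow, Int.natAbs_natCast] at hN
  -- `12 = p² · |N y|` with `p ≥ 7`
  have : p ^ 2 ∣ 12 := ⟨(Algebra.norm ℤ y).natAbs, by norm_num at hN ⊢; linarith⟩
  have h49 : 49 ≤ p ^ 2 := by nlinarith
  exact absurd (Nat.le_of_dvd (by norm_num) this) (by omega)


/-- **`[w]_m` has order exactly `2`** in `I_K(m)/P_{K,ℤ}(m)` (`3 ∤ m`, `p ∣ m`, `p ≡ 1 (3)`).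
[cite: Cox2013, §7.D (7.27), Exercise 7.30 (a), §9.A (9.1) (PDF pp. 161, 171, 192)] -/
theorem JZero.orderOf_primeClass_three (hω : ω ^ 2 + ω + 1 = 0) (h2 : finrank ℚ K = 2)
    (w : HeightOneSpectrum (𝓞 K)) (h3w : ((3 : ℕ) : 𝓞 K) ∈ w.asIdeal) {m p : ℕ} (hm3 : ¬ 3 ∣ m)
    (hp : p.Prime) (hp3 : p % 3 = 1) (hpm : p ∣ m) : orderOf (primeClass m w) = 2 := by
  have hm1 : m ≠ 1 := by
    rintro rfl
    have := Nat.le_of_dvd one_pos hpm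
    have := hp.two_le
    omega
  haveI : Fact (Nat.Prime 2) := ⟨Nat.prime_two⟩
  exact orderOf_eq_prime (JZero.primeClass_three_sq hω h2 w h3w hm1 hm3)
    (JZero.primeClass_three_ne_one hω h2 w h3w hm3 hp hp3 hpm)

/-! ## §2 Decomposition of `w` in `K[m]`: `e = 1`, `f = 2`, and the Frobenius involution -/

/-- **`f_w(K[m]/K) = 2`**: the residue degree of `w = (1 − ω)` in the ring class field `K[m] ⊂ ℂ` is `2`
(`3 ∤ m`, `p ∣ m`, `p ≡ 1 (3)`). [cite: Cox2013, Cor. 5.21 (ii) and §9.A (9.1) (PDF pp. 122, 192–193: the order of the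
Artin symbol is the inertial degree; `I_K(f)/P_{K,ℤ}(f) ≃ Gal(L/K)`)] [cite: NeukirchANT1999, Ch. VI §7 (7.3)] -/
theorem JZero.inertiaDegIn_ringClassField_three (hω : ω ^ 2 + ω + 1 = 0) (h2 : finrank ℚ K = 2)
    (ι : K →+* ℂ) (w : HeightOneSpectrum (𝓞 K)) (h3w : ((3 : ℕ) : 𝓞 K) ∈ w.asIdeal) {m p : ℕ}
    (hm3 : ¬ 3 ∣ m) (hp : p.Prime) (hp3 : p % 3 = 1) (hpm : p ∣ m) :
    w.asIdeal.inertiaDegIn (𝓞 (ringClassField K ι m)) = 2 := by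
  have hK := JZero.isImaginaryQuadratic_of_sq_add_self_add_one hω h2
  have hm0 : m ≠ 0 := by rintro rfl; exact hm3 (dvd_zero 3)
  rw [inertiaDegIn_ringClassField_eq_orderOf_primeClass hK ι hm0
    (JZero.not_span_natCast_le_of_not_three_dvd w h3w hm3)]
  exact JZero.orderOf_primeClass_three hω h2 w h3w hm3 hp hp3 hpm

/-- `e_w(K[m]/K) = 1`: `w = (1 − ω)` is unramified in `K[m]` for `3 ∤ m`.
[cite: Cox2013, §9.A (PDF p. 193: «all primes of `K` ramified in `L` must divide `f𝒪_K`»)] -/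
theorem JZero.ramificationIdxIn_ringClassField_three (hω : ω ^ 2 + ω + 1 = 0) (h2 : finrank ℚ K = 2)
    (ι : K →+* ℂ) (w : HeightOneSpectrum (𝓞 K)) (h3w : ((3 : ℕ) : 𝓞 K) ∈ w.asIdeal) {m : ℕ}
    (hm0 : m ≠ 0) (hm3 : ¬ 3 ∣ m) :
    w.asIdeal.ramificationIdxIn (𝓞 (ringClassField K ι m)) = 1 :=
  ramificationIdxIn_ringClassField_eq_one (JZero.isImaginaryQuadratic_of_sq_add_self_add_one hω h2) ι
    hm0 (JZero.not_span_natCast_le_of_not_three_dvd w h3w hm3)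

/-- **The Frobenius involution of `D_w`.**  For any `K`-embedding `emb : K[m] → K̄` of the concrete ring class
field, any prime `𝔚` of `\bar ℤ_K` above `w = (1 − ω)` and any arithmetic Frobenius `F ∈ Γ_K` at `𝔚`, there is
`σ ∈ Gal(K[m]/K)` with `σ ≠ 1`, `σ² = 1` and `F ∘ emb = emb ∘ σ` (`3 ∤ m`, `p ∣ m`, `p ≡ 1 (3)`).
[cite: Cox2013, Cor. 5.21 (ii) and §9.A (9.1) (PDF pp. 122, 192–193)] [cite: HuShuYin2019, §2.2 Prop. 2.4 (the tower
`H_{9p} ⊇ H_{3p} ⊇ H_p ⊇ K = ℚ(√−3)`, `p ≡ 1 (mod 3)`)] -/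
theorem JZero.exists_involution_apply_emb_eq_of_isArithFrobAt_three (hω : ω ^ 2 + ω + 1 = 0)
    (h2 : finrank ℚ K = 2) (ι : K →+* ℂ) (w : HeightOneSpectrum (𝓞 K))
    (h3w : ((3 : ℕ) : 𝓞 K) ∈ w.asIdeal) {m p : ℕ} (hm3 : ¬ 3 ∣ m) (hp : p.Prime) (hp3 : p % 3 = 1)
    (hpm : p ∣ m) (emb : ringClassField K ι m →+* AlgebraicClosure K)
    (hemb : ∀ k : K, emb (algebraMap K (ringClassField K ι m) k) = algebraMap K (AlgebraicClosure K) k)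
    {𝔚 : Ideal (absIntegers (𝓞 K) K)} (h𝔚 : 𝔚 ∈ w.primesAbove) {F : absoluteGaloisGroup K}
    (hF : IsArithFrobAt (𝓞 K) F 𝔚) :
    ∃ σ : ringClassField K ι m ≃ₐ[ℚ] ringClassField K ι m,
      σ ∈ ringClassGal ι m ∧ σ ≠ 1 ∧ σ * σ = 1 ∧
        ∀ x : ringClassField K ι m,
          (show AlgebraicClosure K ≃ₐ[K] AlgebraicClosure K from F) (emb x) = emb (σ x) := by
  have hK := JZero.isImaginaryQuadratic_of_sq_add_self_add_one hω h2
  have hm0 : m ≠ 0 := by rintro rfl; exact hm3 (dvd_zero 3)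
  have hv := JZero.not_span_natCast_le_of_not_three_dvd w h3w hm3
  haveI := (finiteDimensional_and_isGalois_ringClassField hK ι hm0).1
  haveI := (finiteDimensional_and_isGalois_ringClassField hK ι hm0).2
  set φ : ringClassField K ι m →ₐ[K] AlgebraicClosure K := AlgHom.mk emb hemb with hφ
  have hL := fieldRange_emb_ringClassField_eq hK ι hm0 emb hemb
  let e : ringClassField K ι m ≃ₐ[K] φ.fieldRange := AlgEquiv.ofInjectiveField φ
  have he : ∀ x, ((e x : φ.fieldRange) : AlgebraicClosure K) = emb x := fun x =>
    AlgEquiv.ofInjective_apply φ φ.toRingHom.injective x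
  haveI : FiniteDimensional K φ.fieldRange := by rw [hL]; infer_instance
  haveI : IsGalois K φ.fieldRange := by rw [hL]; infer_instance
  haveI : NumberField φ.fieldRange := by rw [hL]; infer_instance
  have hunr : ∀ v : HeightOneSpectrum (𝓞 K), ¬ Ideal.span {(m : 𝓞 K)} ≤ v.asIdeal →
      Algebra.IsUnramifiedIn (𝓞 φ.fieldRange) v.asIdeal := by
    rw [hL]; exact fun v hv => isUnramifiedIn_classFieldOfIdealGroup_ringClassDen hm0 hv
  have hsplit : ∀ v : HeightOneSpectrum (𝓞 K), ¬ Ideal.span {(m : 𝓞 K)} ≤ v.asIdeal →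
      (v ∈ splitPrimes K φ.fieldRange ↔ primeClass m v = 1) := by
    rw [hL]; exact fun v hv => mem_splitPrimes_classFieldOfIdealGroup_ringClassDen_iff hm0 hv
  haveI : Finite (RingClassGroup K m) := finite_ringClassGroup h2 hm0
  obtain ⟨art, hart⟩ := exists_artinEquiv_abs m hm0 φ.fieldRange hunr hsplit
  set σ' := absRestrictNormalHom φ.fieldRange F with hσ'def
  have hord' : orderOf σ' = 2 := by
    rw [← MulEquiv.orderOf_eq art σ', hart w hv 𝔚 h𝔚 F hF]
    exact JZero.orderOf_primeClass_three hω h2 w h3w hm3 hp hp3 hpm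
  have hr : ∀ y : φ.fieldRange, ((σ' y : φ.fieldRange) : AlgebraicClosure K) = F • (y : AlgebraicClosure K) :=
    fun y => AlgEquiv.restrictNormalHom_apply _ _ y
  -- transport to `K[m]`
  let σK : ringClassField K ι m ≃ₐ[K] ringClassField K ι m := e.trans (σ'.trans e.symm)
  have hσK : ∀ x, σK x = e.symm (σ' (e x)) := fun _ => rfl
  have hconj : σK = (AlgEquiv.autCongr e).symm σ' := rfl
  have hordK : orderOf σK = 2 := by rw [hconj, MulEquiv.orderOf_eq, hord']
  have hσℚ : ∀ r : ℚ, σK (algebraMap ℚ (ringClassField K ι m) r) = algebraMap ℚ _ r := fun r => by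
    rw [eq_ratCast (algebraMap ℚ (ringClassField K ι m)) r, map_ratCast]
  let σ : ringClassField K ι m ≃ₐ[ℚ] ringClassField K ι m := { σK with commutes' := hσℚ }
  have hσ : ∀ x, σ x = σK x := fun _ => rfl
  refine ⟨σ, ?_, ?_, ?_, ?_⟩
  · rw [ringClassGal, mem_fixingSubgroup_iff]
    rintro y ⟨k, hk⟩
    have hy : y = algebraMap K (ringClassField K ι m) k :=
      Subtype.ext (by rw [coe_algebraMap_ringClassField]; exact hk.symm)
    show σ y = y
    rw [hσ, hy, AlgEquiv.commutes]
  · intro h1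
    have : σK = 1 := AlgEquiv.ext fun x => by rw [← hσ, h1]; rfl
    rw [this, orderOf_one] at hordK
    exact absurd hordK (by norm_num)
  · apply AlgEquiv.ext
    intro x
    have h := pow_orderOf_eq_one σK
    rw [hordK, pow_two] at h
    have hx := congrArg (fun f : ringClassField K ι m ≃ₐ[K] ringClassField K ι m => f x) h
    simpa only [AlgEquiv.mul_apply, AlgEquiv.one_apply, ← hσ] using hx
  · intro x
    have h1 : ((σ' (e x) : φ.fieldRange) : AlgebraicClosure K) = F • emb x := by rw [hr, he]
    rw [absoluteGaloisGroup.smul_def] at h1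
    have h2' : emb (e.symm (σ' (e x))) = ((σ' (e x) : φ.fieldRange) : AlgebraicClosure K) := by
      rw [← he, AlgEquiv.apply_symm_apply]
    rw [hσ, hσK, h2', h1]
    rfl

end Literature.NumberTheory.EllipticCurves.HuShuYin2019

end
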